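import Summits.ABC.IUTFork.Cor312HullFrameArch
import Summits.ABC.IUTFork.Cor312StatementBridge
import Literature.IUT.LogVolume.LocalFieldVolume
import Literature.IUT.LogVolume.ArchimedeanVolume
import HarnessLib

/-!
# [IUTchIII] Corollary 3.12, statement — real log-volumes for `Cor312.Setting.ofFrames` (all places)

Record-only file (D-0012) of the abc-iut cell (Cor. 3.12 sub-crew, wave 2, seat abc-iut-c312-6, board row W2-C′);
TAKES NO SIDE. Companion of `Cor312VolumesReal` (ULTRAMETRIC packets, `Setting.ofComparison`) for c312-7's per-place
assembler `Setting.ofFrames` (`Cor312HullFrameArch`: `HullFrame.ofLocalFields` at nonarchimedean `v_ℚ`,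
`HullFrame.ofNormSurjective` at the archimedean one); same binders `Adm`/`logvol`/`hadm`. Per place only the VOLUME
ON EACH FIELD FACTOR differs:

* §1 `FactorVolume K` — a monotone volume on a normed field, finite and nonzero on closed balls of positive radius,
  `1` on the unit ball: NONARCHIMEDEAN = Haar with `μ(𝒪_K) = 1` ([AbsTopIII] Prop. 5.7 (i); S2 `localVolume`,
  `ofUltrametric`); ARCHIMEDEAN (`ℂ`) = the RADIAL volume `length(pr_ℝ(A))`, `μ_k(𝒪_k) = 1` ([AbsTopIII] Prop. 5.7
  (ii); S2 `radialVolume`, `complexRadial`; [IUTchIII] Prop. 3.9 (i) p. 116); `precomp` transports (e.g. `K_v ≅ ℂ`).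
  `μ.logvol A = log μ(A)`, `μ.mulLogvol x = log μ(B(0,‖x‖))` (nonarch: S2 `mulLogVolume`; arch: `log ‖x‖`).
* §2 `FrameVolumePieces L` — per packet: field factors `K_i` (any nontrivially normed fields), a SURJECTIVE
  comparison `e` from c312-1's algebraic packet, a factor volume `vol_i`, nonnegative weights `w_i` ([IUTchIII]
  Rmk. 3.1.1 (ii) p. 94), and a hull frame `frameK` with `hul_iff` (as in c312-7's `RealFrames`). `V.Adm` := the
  image is a box `Π_i R_i` over the FIELD FACTORS with `0 < vol_i(R_i) < ∞` — the HULL-LEVEL admissibility.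
  CAVEAT (seat c312-5, INBOX 2026-08-25T23:03Z, agreed; reviewer of p410773 note 4): the printed `𝕄(−)` of
  [IUTchIII] Rmk. 3.1.1 (iii) p. 95 ("a direct product of compact subsets of positive measure in each of the direct
  summands") takes products over the SUMMANDS `v⃗` (`M_{v⃗} = ⊗_α K_{v_α}`) with arbitrary COMPACT positive-measure
  subsets of each summand: coarser than field-boxes (and (Ind1)/(Ind2)-stable, which field-boxes are not — an
  Ism-element is `ℚ_p`-linear on a summand, not multiplicative), while compactness of the factors is not demanded
  here. The notions AGREE ON HULL-SETS `λ·𝒪_L`, which is all that `hadm`, `qLocal`, `thetaLocal` and the `q`-support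
  read; the skeleton-route fields `image_adm`/`image_fin` of `BridgeHyps` need the summandwise container (c312-5
  `Cor312VolumesSummands`). `V.logvol` := `Σ_i w_i·log vol_i(pr_i e(A))` (on field-boxes the printed weighted sum
  when the summand measures are normalized by `Π_i 𝒪_{K_i}` and `w_i` is the weight of the summand containing `i`;
  elsewhere a junk value never read here). PROVED: hull-sets admissible; `logvol` monotone on admissible regions;
  closed form `Σ_i w_i·μ̇^log_i(λ_i)` on `e⁻¹(λ·𝒪_L)`, `= 0` for unit norms.
* §3 for `Setting.ofFrames n lat sig split qData (V.toRealFrames θBox qC) hq hadm hfin` over a line realizing `V`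
  (`Realizes`): `hadm` DISCHARGED (`hadm_of_realizes`); `BridgeHyps.mono`/`.hul_nonempty` DISCHARGED; `qLocal` in
  CLOSED FORM `Σ_i w_i·μ̇^log_i(λ_{q,i})` (`= 0` for unit centres ⇒ `hfin` from cofinitely-trivial centres);
  `thetaLocal` in closed form given the hull-set `λ·𝒪_L` of the union of the possible images.

Sources read on the page: [IUTchIII] kurims `paper:url-4b091feeb646` pp. 94–95, 115–116, 127, 173–175.
[claim: Mochizuki2012, status: disputed] for the quoted definitions; everything proved is bookkeeping. RESIDUAL
BINDERS NOT TOUCHED: `e` (S1 `piTensorDistrib` ∘ c312-3 `dEquiv`), `thetaBox`/`qCentre` (c312-3), `lat`/`sig`/`split`/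
`qData`, exact weights, Hermitian unit balls at `v_ℚ ∈ 𝕍_ℚ^arc` (L5-t7). Deliberately NOT here: any judgement.
-/

noncomputable section

open Set MeasureTheory Metric
open scoped ENNReal Pointwise

namespace Summit.ABC

namespace IUTFork

namespace Cor312Vol

open Thm311 Cor312 Literature.IUT.LogVolume Literature.IUT.LogThetaLattice

variable {T : ThetaIndex}

/-! ## 1. Factor volumes: Haar at nonarchimedean factors, radial at archimedean factors -/

/-- A **factor volume** on a normed field `K`: a monotone `ℝ≥0∞`-valued set function, `0` on `∅`, finite on closed
balls, nonzero on closed balls of positive radius, `1` on `𝒪_K` — the common shape of [AbsTopIII] Prop. 5.7 (i)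
(Haar, `μ_k(𝒪_k) = 1`) and (ii) (radial, `μ_k(𝒪_k) = 1`). [cite: MochizukiAbsTopIII2015, Prop. 5.7 (i)(ii) pp. 137–138] -/
structure FactorVolume (K : Type) [NormedField K] : Type where
  /-- the volume -/
  vol : Set K → ℝ≥0∞
  /-- monotone -/
  mono : ∀ ⦃A B : Set K⦄, A ⊆ B → vol A ≤ vol B
  /-- `vol ∅ = 0` -/
  empty : vol ∅ = 0
  /-- closed balls have finite volume -/
  ball_ne_top : ∀ r : ℝ, vol (closedBall 0 r) ≠ ∞
  /-- closed balls of positive radius have nonzero volume -/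
  ball_ne_zero : ∀ r : ℝ, 0 < r → vol (closedBall 0 r) ≠ 0
  /-- normalisation `μ(𝒪_K) = 1` -/
  ball_one : vol (closedBall 0 1) = 1

namespace FactorVolume

variable {K : Type} [NormedField K] (μ : FactorVolume K)

/-- `μ^log(A) := log μ(A)` ([AbsTopIII] Prop. 5.7 "log-volume"). [cite: MochizukiAbsTopIII2015, Prop. 5.7 (i)(ii) pp. 137–138] -/
def logvol (A : Set K) : ℝ := Real.log (μ.vol A).toReal

/-- `μ̇^log(x) := μ^log(B(0, ‖x‖))` (`= μ^log(x·𝒪_K)`). [cite: MochizukiAbsTopIII2015, Prop. 5.7 (i)(ii) pp. 137–138] -/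
def mulLogvol (x : K) : ℝ := μ.logvol (closedBall 0 ‖x‖)

/-- `μ̇^log(x) = 0` for `‖x‖ = 1` (`μ(𝒪_K) = 1`). [cite: MochizukiAbsTopIII2015, Prop. 5.7 (i)(ii) pp. 137–138] -/
theorem mulLogvol_of_norm_eq_one {x : K} (hx : ‖x‖ = 1) : μ.mulLogvol x = 0 := by
  simp [mulLogvol, logvol, hx, μ.ball_one]

/-- Monotonicity of `μ^log` between sets of nonzero finite volume. [folklore] -/
theorem logvol_mono {A B : Set K} (hA : μ.vol A ≠ 0) (hB : μ.vol B ≠ ∞) (h : A ⊆ B) :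
    μ.logvol A ≤ μ.logvol B :=
  Real.log_le_log (ENNReal.toReal_pos hA (ne_top_of_le_ne_top hB (μ.mono h)))
    (ENNReal.toReal_mono hB (μ.mono h))

/-- A set of nonzero volume is nonempty. [folklore] -/
theorem nonempty_of_vol_ne_zero {A : Set K} (hA : μ.vol A ≠ 0) : A.Nonempty := by
  by_contra h
  exact hA (by rw [Set.not_nonempty_iff_eq_empty.mp h, μ.empty])

/-- **Nonarchimedean factor volume**: the Haar measure with `μ(𝒪_K) = 1` (S2 `localVolume`).
[cite: MochizukiAbsTopIII2015, Prop. 5.7 (i) p. 137] -/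
def ofUltrametric (K : Type) [NontriviallyNormedField K] [IsUltrametricDist K] [ProperSpace K]
    [MeasurableSpace K] [BorelSpace K] : FactorVolume K where
  vol A := localVolume K A
  mono _ _ h := measure_mono h
  empty := measure_empty
  ball_ne_top r := ((isCompact_closedBall (0 : K) r).measure_lt_top (μ := localVolume K)).ne
  ball_ne_zero r hr :=
    ((IsUltrametricDist.isOpen_closedBall (0 : K) hr.ne').measure_pos (localVolume K) ⟨0, by simp [hr.le]⟩).ne'
  ball_one := localVolume_closedBall_one K

/-- At a nonarchimedean factor `μ̇^log` IS S2's `mulLogVolume` (`μ^log(B(0,‖x‖)) = μ^log(x·𝒪_K)`).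
[cite: MochizukiAbsTopIII2015, Prop. 5.7 (i)(b) p. 138] -/
theorem ofUltrametric_mulLogvol (K : Type) [NontriviallyNormedField K] [IsUltrametricDist K] [ProperSpace K]
    [MeasurableSpace K] [BorelSpace K] (x : Kˣ) :
    (ofUltrametric K).mulLogvol (x : K) = mulLogVolume K x := by
  rw [mulLogVolume, mulVolume, Literature.NumberTheory.GaloisRepresentations.Ultrametric.units_smul_unitBall]
  rfl

/-- **Archimedean factor volume** on `ℂ`: the RADIAL volume `μ_k(A) = length(pr_ℝ(A))` with `μ_k(𝒪_k) = 1` (S2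
`radialVolume`). [cite: MochizukiAbsTopIII2015, Prop. 5.7 (ii) p. 138] -/
def complexRadial : FactorVolume ℂ where
  vol := radialVolume
  mono _ _ h := measure_mono (Set.image_mono h)
  empty := by simp [radialVolume]
  ball_ne_top r := (radialVolume_lt_top (isCompact_closedBall (0 : ℂ) r)).ne
  ball_ne_zero r hr := by
    have h : closedBall (0 : ℂ) r = (r : ℂ) • closedBall (0 : ℂ) 1 := by
      rw [smul_unitClosedBall, Complex.norm_of_nonneg hr.le]
    rw [h, radialVolume_smul, radialVolume_closedBall_one, mul_one, Complex.norm_of_nonneg hr.le]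
    exact (ENNReal.ofReal_pos.mpr hr).ne'
  ball_one := radialVolume_closedBall_one

/-- At the archimedean factor `μ̇^log(x) = log ‖x‖` (S2 `radialMulLogVolume_eq`).
[cite: MochizukiAbsTopIII2015, Prop. 5.7 (ii)(b) p. 138] -/
theorem complexRadial_mulLogvol (x : ℂ) : complexRadial.mulLogvol x = Real.log ‖x‖ := by
  rw [← radialMulLogVolume_eq, radialMulLogVolume, radialMulVolume, smul_unitClosedBall]
  rfl

/-- Transport of a factor volume along a map preserving closed balls about `0` (e.g. an isometric isomorphism
`K_v ≅ ℂ` at a complex place). [folklore] -/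
def precomp {K' : Type} [NormedField K'] (μ : FactorVolume K') (f : K → K')
    (hf : ∀ r : ℝ, f '' closedBall 0 r = closedBall 0 r) : FactorVolume K where
  vol A := μ.vol (f '' A)
  mono _ _ h := μ.mono (Set.image_mono h)
  empty := by rw [Set.image_empty, μ.empty]
  ball_ne_top r := by rw [hf]; exact μ.ball_ne_top r
  ball_ne_zero r hr := by rw [hf]; exact μ.ball_ne_zero r hr
  ball_one := by rw [hf]; exact μ.ball_one

end FactorVolume

/-! ## 2. Volume pieces with per-packet frames: the concrete `Adm` and `logvol` -/

/-- **Volume pieces with per-packet hull frames** over c312-1's log-shell signature `L` (c312-7's `RealFrames` minus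
the pilot regions, plus volumes): field factors, a SURJECTIVE comparison `e`, a factor volume and a nonnegative
weight per factor (Rmk. 3.1.1 (ii) p. 94), a hull frame per packet with hull-sets `λ·𝒪_L`. [claim: Mochizuki2012, status: disputed] -/
structure FrameVolumePieces (L : LogShells T) : Type 1 where
  /-- index of the field factors at `(j, v_ℚ)` -/
  J : T.Label → T.VQ → Type
  /-- … finitely many -/
  [instFintype : ∀ j vQ, Fintype (J j vQ)]
  /-- the field factors -/
  K : ∀ j vQ, J j vQ → Type
  /-- … nontrivially normed fields -/
  [instField : ∀ j vQ i, NontriviallyNormedField (K j vQ i)]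
  /-- the comparison map ([IUTchIII] Prop. 3.1 (i), 3.2 (i)) -/
  e : ∀ j vQ, L.Packet j vQ → ∀ i, K j vQ i
  /-- … is onto -/
  e_surjective : ∀ j vQ, Function.Surjective (e j vQ)
  /-- the volume on each factor (Haar / radial) -/
  vol : ∀ j vQ i, FactorVolume (K j vQ i)
  /-- the weights (Rmk. 3.1.1 (ii)) -/
  w : ∀ j vQ, J j vQ → ℝ
  /-- … nonnegative -/
  w_nonneg : ∀ j vQ i, 0 ≤ w j vQ i
  /-- the real hull frame of each packet -/
  frameK : ∀ j vQ, HullFrame (∀ i, K j vQ i)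
  /-- … whose hull-sets are `λ·𝒪_L` -/
  hul_iff : ∀ j vQ (H : Set (∀ i, K j vQ i)), H ∈ (frameK j vQ).Hul ↔ IsHullSet (K j vQ) H

attribute [instance] FrameVolumePieces.instFintype FrameVolumePieces.instField

namespace FrameVolumePieces

variable {L : LogShells T} (V : FrameVolumePieces L)

/-- **BOX-admissible regions (hull level)**: the image is a box `Π_i R_i` over the field factors with
`0 < vol_i(R_i) < ∞` — finer than the printed `𝕄(−)` of [IUTchIII] Rmk. 3.1.1 (iii) p. 95 (products over the
SUMMANDS, arbitrary compact positive-measure subsets), equal to it on hull-sets (module docstring CAVEAT).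
[claim: Mochizuki2012, status: disputed] -/
@[claim "Mochizuki2012" "disputed"]
def Adm (j : T.Label) (vQ : T.VQ) (A : Set (L.Packet j vQ)) : Prop :=
  ∃ R : ∀ i, Set (V.K j vQ i), V.e j vQ '' A = Set.pi univ R ∧
    ∀ i, (V.vol j vQ i).vol (R i) ≠ 0 ∧ (V.vol j vQ i).vol (R i) ≠ ∞

/-- **The log-volume on field-boxes**: `Σ_i w_i·log vol_i(pr_i e(A))` ([IUTchIII] Rmk. 3.1.1 (ii)/(iv); Prop. 3.9
(i)); on box-admissible regions the weighted sum of the factors' log-volumes (= the printed one under the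
normalisation of the module docstring), elsewhere a junk value. [claim: Mochizuki2012, status: disputed] -/
def logvol (j : T.Label) (vQ : T.VQ) (A : Set (L.Packet j vQ)) : ℝ :=
  ∑ i, V.w j vQ i * (V.vol j vQ i).logvol (Function.eval i '' (V.e j vQ '' A))

variable (j : T.Label) (vQ : T.VQ)

/-- The log-volume of the preimage of a box with nonempty factors is the weighted sum over the factors. [folklore] -/
theorem logvol_preimage_pi {R : ∀ i, Set (V.K j vQ i)} (hR : ∀ i, (R i).Nonempty) :
    V.logvol j vQ (V.e j vQ ⁻¹' Set.pi univ R) = ∑ i, V.w j vQ i * (V.vol j vQ i).logvol (R i) := by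
  classical
  unfold logvol
  refine Finset.sum_congr rfl fun i _ => ?_
  rw [Set.image_preimage_eq _ (V.e_surjective j vQ), Set.eval_image_univ_pi (Set.univ_pi_nonempty_iff.mpr hR)]

/-- **Hull-sets are admissible** (`hadm`, PROVED): `λ·𝒪_L = Π_i B(0, ‖λ_i‖)`, `λ_i ≠ 0`.
[cite: Mochizuki2012, IUTchIII Rmk. 3.9.5 (ii) p. 127] -/
theorem adm_preimage_of_isHullSet {H : Set (∀ i, V.K j vQ i)} (hH : IsHullSet (V.K j vQ) H) :
    V.Adm j vQ (V.e j vQ ⁻¹' H) := by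
  obtain ⟨c, hc, rfl⟩ := hH
  refine ⟨fun i => closedBall 0 ‖c i‖, by rw [Set.image_preimage_eq _ (V.e_surjective j vQ)]; rfl,
    fun i => ⟨(V.vol j vQ i).ball_ne_zero _ (norm_pos_iff.mpr (hc i)), (V.vol j vQ i).ball_ne_top _⟩⟩

variable {V j vQ}

/-- **Monotonicity of the concrete log-volume on admissible regions** (`BridgeHyps.mono`, PROVED). [folklore] -/
theorem logvol_mono {A B : Set (L.Packet j vQ)} (hA : V.Adm j vQ A) (hB : V.Adm j vQ B) (hAB : A ⊆ B) :
    V.logvol j vQ A ≤ V.logvol j vQ B := by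
  classical
  obtain ⟨RA, hRA, hA'⟩ := hA
  obtain ⟨RB, hRB, hB'⟩ := hB
  have hneA : ∀ i, (RA i).Nonempty := fun i => (V.vol j vQ i).nonempty_of_vol_ne_zero (hA' i).1
  have hneB : ∀ i, (RB i).Nonempty := fun i => (V.vol j vQ i).nonempty_of_vol_ne_zero (hB' i).1
  have hsub : Set.pi univ RA ⊆ Set.pi univ RB := by rw [← hRA, ← hRB]; exact Set.image_mono hAB
  have hfac : ∀ i, RA i ⊆ RB i := by
    rcases Set.univ_pi_subset_univ_pi_iff.mp hsub with h | ⟨i, hi⟩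
    · exact h
    · exact absurd hi (hneA i).ne_empty
  unfold logvol
  rw [hRA, hRB]
  refine Finset.sum_le_sum fun i _ => mul_le_mul_of_nonneg_left ?_ (V.w_nonneg j vQ i)
  rw [Set.eval_image_univ_pi (Set.univ_pi_nonempty_iff.mpr hneA),
    Set.eval_image_univ_pi (Set.univ_pi_nonempty_iff.mpr hneB)]
  exact (V.vol j vQ i).logvol_mono (hA' i).1 (hB' i).2 (hfac i)

variable (V j vQ)

/-- **Closed form on hull-sets**: `μ^log(e⁻¹(λ·𝒪_L)) = Σ_i w_i·μ̇^log_i(λ_i)`. [cite: Mochizuki2012, IUTchIII Rmk. 3.9.5 (iii) p. 128] -/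
theorem logvol_preimage_hullSet (c : ∀ i, V.K j vQ i) :
    V.logvol j vQ (V.e j vQ ⁻¹' hullSet (V.K j vQ) c) = ∑ i, V.w j vQ i * (V.vol j vQ i).mulLogvol (c i) :=
  V.logvol_preimage_pi j vQ fun i => ⟨0, by simp⟩

/-- … `= 0` when every `‖λ_i‖ = 1`. [cite: Mochizuki2012, IUTchIII Prop. 3.9 (i) p. 115] -/
theorem logvol_preimage_hullSet_eq_zero_of_norm_eq_one (c : ∀ i, V.K j vQ i) (hc : ∀ i, ‖c i‖ = 1) :
    V.logvol j vQ (V.e j vQ ⁻¹' hullSet (V.K j vQ) c) = 0 := by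
  rw [logvol_preimage_hullSet]
  exact Finset.sum_eq_zero fun i _ => by rw [(V.vol j vQ i).mulLogvol_of_norm_eq_one (hc i), mul_zero]

/-- Hull-sets are nonempty in the algebraic packet (`λ·𝒪_L ∋ 0`, `e` onto). [folklore] -/
theorem preimage_hullSet_nonempty (c : ∀ i, V.K j vQ i) : (V.e j vQ ⁻¹' hullSet (V.K j vQ) c).Nonempty := by
  obtain ⟨x, hx⟩ := V.e_surjective j vQ 0
  exact ⟨x, by rw [Set.mem_preimage, hx]; exact (mem_polydisc (V.K j vQ)).mpr fun i => by simp⟩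

/-- The line data `D` CARRIES these volumes (pointwise); `Iff.rfl`/`rfl` for `MRData.ofShells … V.Adm V.logvol …`
(`realizes_ofShells`). [folklore] -/
@[folklore]
structure Realizes (V : FrameVolumePieces L) (D : MRData L) : Prop where
  /-- admissible regions -/
  adm_iff : ∀ (j : T.Label) (vQ : T.VQ) (A : Set (L.Packet j vQ)), D.Adm j vQ A ↔ V.Adm j vQ A
  /-- log-volume -/
  logvol_eq : ∀ (j : T.Label) (vQ : T.VQ) (A : Set (L.Packet j vQ)), D.logvol j vQ A = V.logvol j vQ A

/-- Any `MRData` whose `Adm`/`logvol` fields are literally `V.Adm`/`V.logvol` realizes `V` — e.g. c312-5's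
`MRData.ofShells L archPk archSub V.Adm V.logvol Ψ act Mmod`. [folklore] -/
theorem realizes_of_eq {D : MRData L} (hA : D.Adm = V.Adm) (hl : D.logvol = V.logvol) : V.Realizes D :=
  ⟨fun j vQ A => by rw [hA], fun j vQ A => by rw [hl]⟩

/-! ## 3. The assembled setting `Setting.ofFrames` over these volumes -/

section Assembled

variable {S : Situation T} (V : FrameVolumePieces S.L)

/-- c312-7's `RealFrames` from the pieces and the two pilot data. [claim: Mochizuki2012, status: disputed] -/
def toRealFrames {ObLgp ObΔ : Type} (thetaBox : ℤ → ObLgp → ∀ j vQ, Set (∀ i, V.K j vQ i))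
    (qCentre : ObΔ → ∀ j vQ, ∀ i, V.K j vQ i) : Setting.RealFrames S ObLgp ObΔ where
  J := V.J
  K := V.K
  e := V.e
  frameK := V.frameK
  hul_iff := V.hul_iff
  thetaBox := thetaBox
  qCentre := qCentre

variable {V} {n : ℤ}

/-- **The binder `hadm` of `Setting.ofFrames`, DISCHARGED.** [cite: Mochizuki2012, IUTchIII Rmk. 3.9.5 (ii) p. 127] -/
theorem hadm_of_realizes (hV : V.Realizes (S.D n)) :
    ∀ (j : T.Label) (vQ : T.VQ) (H : Set (∀ i, V.K j vQ i)), IsHullSet (V.K j vQ) H →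
      (S.D n).Adm j vQ (V.e j vQ ⁻¹' H) :=
  fun j vQ _ hH => (hV.adm_iff j vQ _).2 (V.adm_preimage_of_isHullSet j vQ hH)

variable {HT : Type} {LogLink : HT → HT → Type} {IsFull : ∀ {s t : HT}, LogLink s t → Prop}
  (lat : LGPGaussianLogThetaLattice LogLink IsFull)
  {Frd : Type} {IsoF : Frd → Frd → Type} {Ob : Frd → Type} {realify : Frd → Frd} {Strip : Type}
  {IsoS : Strip → Strip → Type} {M : ∀ v : T.V, v ∈ T.Vbad → Type} [∀ v h, Monoid (M v h)]
  (sig : GlobalLGPFrobenioidSignature T.lstar T.V (· ∈ T.Vbad) Frd IsoF Ob realify Strip IsoS M)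
  (split : SplittingMonoids M) {ObΔ : Type} {N : ∀ v : T.V, v ∈ T.Vbad → Type} [∀ v h, Monoid (N v h)]
  (qData : QPilotData ObΔ N)
  (thetaBox : ℤ → Ob sig.Clgp → ∀ j vQ, Set (∀ i, V.K j vQ i))
  (qCentre : ObΔ → ∀ j vQ, ∀ i, V.K j vQ i)
  (hq : ∀ j vQ i, qCentre (qPilotObject qData) j vQ i ≠ 0)
  (hadm : ∀ j vQ (H : Set (∀ i, V.K j vQ i)), IsHullSet (V.K j vQ) H → (S.D n).Adm j vQ (V.e j vQ ⁻¹' H))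
  (hfin : ∀ j : T.Label, (Function.support fun vQ => (S.D n).logvol j vQ
    (V.e j vQ ⁻¹' hullSet (V.K j vQ) (qCentre (qPilotObject qData) j vQ))).Finite)

/-- `hfin` from cofinitely-trivial centres ([IUTchIII] Prop. 3.9 (iii)). [cite: Mochizuki2012, IUTchIII Prop. 3.9 (iii) p. 117] -/
theorem qSupport_finite_of_norm_eq_one (hV : V.Realizes (S.D n)) (j : T.Label)
    (h1 : {vQ : T.VQ | ∃ i, ‖qCentre (qPilotObject qData) j vQ i‖ ≠ 1}.Finite) :
    (Function.support fun vQ => (S.D n).logvol j vQ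
      (V.e j vQ ⁻¹' hullSet (V.K j vQ) (qCentre (qPilotObject qData) j vQ))).Finite := by
  refine h1.subset fun vQ hvQ => ?_
  simp only [Function.mem_support, ne_eq] at hvQ
  rw [hV.logvol_eq] at hvQ
  by_contra hne
  simp only [Set.mem_setOf_eq, not_exists, not_not] at hne
  exact hvQ (V.logvol_preimage_hullSet_eq_zero_of_norm_eq_one j vQ _ hne)

/-- **The setting of the printed statement over real volumes at ALL places**: c312-7's `Setting.ofFrames` with
`hadm` discharged. [claim: Mochizuki2012, status: disputed] -/
def settingOfFrameVolumes (hV : V.Realizes (S.D n)) : Cor312.Setting S :=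
  Setting.ofFrames n lat sig split qData (V.toRealFrames thetaBox qCentre) hq (hadm_of_realizes hV) hfin

/-- **The local `q`-volume in CLOSED FORM**: `qLocal j v_ℚ = Σ_i w_i·μ̇^log_i(λ_{q,i})` (nonarch factor:
`−ord(λ)·log q_K` via `ofUltrametric_mulLogvol` + S8 `mulLogVolume_eq_neg_ordFun`; arch: `log ‖λ‖`).
[claim: Mochizuki2012, status: disputed] -/
theorem qLocal_ofFrames (hV : V.Realizes (S.D n)) (j : T.Label) (vQ : T.VQ) :
    (Setting.ofFrames n lat sig split qData (V.toRealFrames thetaBox qCentre) hq hadm hfin).qLocal j vQ =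
      ∑ i, V.w j vQ i * (V.vol j vQ i).mulLogvol (qCentre (qPilotObject qData) j vQ i) := by
  show (S.D n).logvol j vQ (V.e j vQ ⁻¹' hullSet (V.K j vQ) (qCentre (qPilotObject qData) j vQ)) = _
  rw [hV.logvol_eq]
  exact V.logvol_preimage_hullSet j vQ _

/-- At a `v_ℚ` where the `q`-centre has unit norms the local `q`-volume vanishes. [cite: Mochizuki2012, IUTchIII Prop. 3.9 (iii) p. 117] -/
theorem qLocal_ofFrames_eq_zero (hV : V.Realizes (S.D n)) (j : T.Label) (vQ : T.VQ)
    (h1 : ∀ i, ‖qCentre (qPilotObject qData) j vQ i‖ = 1) :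
    (Setting.ofFrames n lat sig split qData (V.toRealFrames thetaBox qCentre) hq hadm hfin).qLocal j vQ = 0 := by
  show (S.D n).logvol j vQ (V.e j vQ ⁻¹' hullSet (V.K j vQ) (qCentre (qPilotObject qData) j vQ)) = 0
  rw [hV.logvol_eq]
  exact V.logvol_preimage_hullSet_eq_zero_of_norm_eq_one j vQ _ h1

/-- **`BridgeHyps.mono` DISCHARGED** for the per-frame setting. [folklore] -/
theorem logvolMono_ofFrames (hV : V.Realizes (S.D n)) :
    LogvolMono (Setting.ofFrames n lat sig split qData (V.toRealFrames thetaBox qCentre) hq hadm hfin) := by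
  intro i vQ A B hA hB hAB
  show (S.D n).logvol _ vQ A ≤ (S.D n).logvol _ vQ B
  rw [hV.logvol_eq, hV.logvol_eq]
  exact V.logvol_mono ((hV.adm_iff _ vQ A).1 hA) ((hV.adm_iff _ vQ B).1 hB) hAB

/-- **`BridgeHyps.hul_nonempty` DISCHARGED** for the per-frame setting. [folklore] -/
theorem hul_nonempty_ofFrames (j : T.Label) (vQ : T.VQ) :
    ∀ H ∈ ((Setting.ofFrames n lat sig split qData (V.toRealFrames thetaBox qCentre) hq hadm hfin).frame
      j vQ).Hul, H.Nonempty := by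
  rintro H ⟨H', hH', rfl⟩
  obtain ⟨c, -, rfl⟩ := (V.hul_iff j vQ H').1 hH'
  exact V.preimage_hullSet_nonempty j vQ c

/-- **The local `−|log(Θ)|` in CLOSED FORM, given the hull** `λ·𝒪_L` of the image of the union of the possible images
(some hull-set by `HullFrame.hull_mem_of_hasHull`; = S2 `holomorphicHull`, the polydisc of the radii, for c312-7's two
frames): `thetaLocal j v_ℚ = Σ_i w_i·μ̇^log_i(λ_i)`. [claim: Mochizuki2012, status: disputed] -/
theorem thetaLocal_ofFrames_of_hull_eq (hV : V.Realizes (S.D n)) (j : T.Label) (vQ : T.VQ)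
    (h : (Setting.ofFrames n lat sig split qData (V.toRealFrames thetaBox qCentre) hq hadm hfin).HullDefined j vQ)
    (c : ∀ i, V.K j vQ i)
    (hc : (V.frameK j vQ).hull (V.e j vQ '' ⋃₀ (Setting.ofFrames n lat sig split qData
      (V.toRealFrames thetaBox qCentre) hq hadm hfin).possibleImages j vQ) = hullSet (V.K j vQ) c) :
    (Setting.ofFrames n lat sig split qData (V.toRealFrames thetaBox qCentre) hq hadm hfin).thetaLocal j vQ =
      ((∑ i, V.w j vQ i * (V.vol j vQ i).mulLogvol (c i) : ℝ) : WithTop ℝ) := by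
  unfold Setting.thetaLocal
  rw [if_pos h]
  congr 1
  have hb : (V.frameK j vQ).IsBounded (V.e j vQ '' ⋃₀ (Setting.ofFrames n lat sig split qData
      (V.toRealFrames thetaBox qCentre) hq hadm hfin).possibleImages j vQ) := h.1
  show (S.D n).logvol j vQ (((V.frameK j vQ).comap (V.e j vQ)).hull _) = _
  rw [hV.logvol_eq, HullFrame.comap_hull _ _ hb, hc]
  exact V.logvol_preimage_hullSet j vQ c

end Assembled

end FrameVolumePieces

end Cor312Vol

end IUTFork

end Summit.ABC
end
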